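import Summits.BirchSwinnertonDyer.Rank1Residual.GaloisImage.EPCPrimeTorsion
import Summits.BirchSwinnertonDyer.Rank1Residual.GaloisImage.EPCReductionToPrimeTorsion
import Literature.NumberTheory.GaloisRepresentations.LocalEulerPoincareCharacteristic
import HarnessLib

/-!
# Tate's local Euler–Poincaré characteristic formula (all finite modules)
# (cell `b2b-bsdres`, team n1011, row T-EPC = Tate's local Euler–Poincaré characteristic; seat p04 GEN 8; stage D7′)

HONEST FRAMING (cell `b2b-bsdres`, run/shared/lean/b2b/bsd-rank1-residual/, verbatim in every
file): the goal of the cell is to DELETE the COMBINATION-SHAPED residual classes of the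
Birch–Swinnerton-Dyer formula for ALL analytic-rank `≤ 1` elliptic curves over `ℚ` — "full BSD
formula for every rank `≤ 1` curve in class `C`" assembled STRICTLY from published theorems — so
that the rank-`≤ 1` remainder becomes exactly the CONSTRUCTION-SHAPED classes, which are TYPED
(missing-input `Prop`s), NOT attempted. This is not "finishing BSD". Team n1011 (N10 / N11, the
additive block X4 ∧ `p = 3`): research route; no claim beyond the stated classes; nothing is
booked; no mark / label is changed by this file. Theorems only (no definition, no named fact, no
`sorry`).  (Placement: Summits/GaloisImage with the T-EPC cone.)

## What

`EPCTate.localEulerPoincare` — **Tate's local Euler–Poincaré characteristic formula** (Milne,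
*ADT* I Thm. 2.8; Serre, *CG* II §5.7 Thm. 5): for a non-archimedean local field `F` of
characteristic `0` and every finite discrete `Γ_F`-module `M`, `H¹(F, M)`, `H²(F, M)` are finite and
`#H⁰(F, M) · #H²(F, M) · #(𝒪_F / #M 𝒪_F) = #H¹(F, M)`; and `EPCTate.localEulerPoincareCharacteristic`
— the same packaged as the tree's `Prop` `localEulerPoincareCharacteristic F` (statement verbatim,
nothing restated).  Proof: reduction to modules killed by one prime (stage D2), the tree's
`ℓ ≠ p` theorem, and stage D6 for `ℓ = p`.  (The `_root_`-named discharge of the fact is the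
sibling file `LocalEulerPoincareCharacteristicHolds.lean`, under review for its naming only.)

References: J. S. Milne, *Arithmetic Duality Theorems* (2006), I §2 Thm. 2.8 [MilneADT2006];
J.-P. Serre, *Galois Cohomology* (1997), II §5.7 Thm. 5 [SerreGaloisCohomology1997].
-/

noncomputable section

open CategoryTheory Function Field
open scoped ValuativeRel
open Literature.NumberTheory.GaloisRepresentations

universe u

namespace Summit.BirchSwinnertonDyer.Rank1Residual.GaloisImage

namespace EPCTate

variable (F : Type u) [Field F] [ValuativeRel F] [TopologicalSpace F] [IsNonarchimedeanLocalField F]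
  [CharZero F]

/-- **Tate's local Euler–Poincaré characteristic formula**, as the tree's `Prop`
`localEulerPoincareCharacteristic F`. [cite: MilneADT2006, I §2 Thm 2.8 (p. 31)]
[cite: SerreGaloisCohomology1997, II §5.7 Thm. 5] -/
theorem localEulerPoincareCharacteristic : localEulerPoincareCharacteristic F := by
  intro M _ _ _ _ ρ
  refine EPCMul.localEPC_of_forall_prime F (fun ℓ _ A _ _ _ _ τ hℓ => ?_) ρ
  by_cases h : ℓ = ringChar 𝓀[F]
  · subst h
    exact EPCPrime.localEPC F τ hℓ
  · exact localEulerPoincareCharacteristic_of_isPrimaryTorsion_of_ne F τ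
      (fun a => ⟨1, by rw [pow_one]; exact hℓ a⟩) h

/-- **Tate's local Euler–Poincaré characteristic formula**, unfolded: for every finite discrete
`Γ_F`-module `M`, `H¹(F, M)` and `H²(F, M)` are finite and
`#H⁰(F,M) · #H²(F,M) · #(𝒪_F/#M 𝒪_F) = #H¹(F,M)`. [cite: MilneADT2006, I §2 Thm 2.8 (p. 31)]
[cite: SerreGaloisCohomology1997, II §5.7 Thm. 5] -/
theorem localEulerPoincare {M : Type u} [AddCommGroup M] [TopologicalSpace M] [DiscreteTopology M]
    [Finite M] (ρ : ContinuousRep (absoluteGaloisGroup F) ℤ M) :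
    Finite (continuousCohomology 1 ρ.toTopRep) ∧ Finite (continuousCohomology 2 ρ.toTopRep) ∧
      Nat.card ρ.toTopRep.ρ.invariants * Nat.card (continuousCohomology 2 ρ.toTopRep) *
          Nat.card (𝒪[F] ⧸ Ideal.span {((Nat.card M : ℕ) : 𝒪[F])}) =
        Nat.card (continuousCohomology 1 ρ.toTopRep) :=
  localEulerPoincareCharacteristic F ρ

end EPCTate

end Summit.BirchSwinnertonDyer.Rank1Residual.GaloisImage

end
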